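import Summits.QuantumFields.BalabanUV.Beta.GAN24.RespKernelColumnCharge
import Summits.QuantumFields.BalabanUV.Beta.GAN24.TwoFaceWordAdditive
import Summits.QuantumFields.BalabanUV.Beta.GAN24.ExchangeSlotResum
import Summits.QuantumFields.BalabanUV.Beta.GAN24.CoarseBondCellPairing

/-!
# `BalabanUV.Beta.GAN24.SlotColumnTwoFaceWord` — binder row G-an2-4 ∕ (CONV-C), W-slot CT-W, conservation law (C)∕(C)sym, step (L3c)(iv) of this lineage's note
# `HOME/b2b-balaban-gan24-formalise-leaf-04/g66/CSYM-LEVEL0-KERNEL-BLUEPRINT.md` §8: **THE TWO-FACE WORD `FF[dM K′ N S M ν c]` OF THE BACKGROUND DERIVATIVE THROUGH AN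
# ARBITRARY DECAYING KERNEL `K′` IS THE `(ν, c)`-COLUMN OF `K′` PAIRED WITH THE TWO-LEG FACE CURRENTS OF THE TABLES**, and — for a BLOCK-COVARIANT `K′ = 𝒦` — **THE CELL
# PAIRING OF THE COLUMN CHARGES OF `𝒦` WITH THOSE CURRENTS** (every outer bond `c` gives the same number)

NOT IN PRINT; OUR BOOKKEEPING ([folklore] tsum bookkeeping over TREE objects BY NAME: an4's `OneStepKernelFamily.vertexOfK ∕ colH ∕ abs_colH_le ∕ vertexFamily_vertexOfK`, an2's
`SecondOrderResponse.vertexOfM ∕ colM ∕ dM ∕ vertexFamily_vertexOfM`, leaf-13's `MultiplierVertexBondSum.abs_colM_le_fine`, this lineage's 29 `TwoFaceWordAdditive.summable_twoFace_of_biLoc`,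
22 `ExchangeSlotResum.tsum_twoFace_shiftK`, 13 `CoarseBondCellPairing.tsum_sum_mul_periodic_of_cov`; G-an2-4 formalisation swarm, leaf prover `b2b-balaban-gan24-formalise-leaf-04`, gen 67).
HONEST FRAMING (cell contract, verbatim): «discharging `BetaPertH` makes Bałaban's UV stability UNCONDITIONAL — a real constructive-QFT result; it is NOT the continuum limit and NOT
the Clay problem.»  HONEST DEPENDENCY (verbatim): «continuum YM on T⁴ ⇐ BetaPertH ∧ nine spine estimates (0/9 proved); BetaPertH ⇐ (D1) ∧ (D4) ∧ CAP+tail; G-an2-4 gates asym, D1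
and NE2/3/4.»

WHY (blueprint §8 (L3c); this gen's mechanism note, journal [LEAF04-G67-INTENT35]).  After moving the lattice sum of the outer-summed response word onto the inner bond, the word
reads `Σ'_{c′} FF[dM (K2_{μc′}) Lc S M ν c]`; each summand is the two-face word of `dM K′ …` for the FIXED decaying kernel `K′ = K2_{μc′}`, and their sum is the same word for the
block-covariant decaying kernel `𝒦_μ = Σ'_{c′} K2_{μc′}`.  This file supplies the two generic read-outs: (§1) for any decaying `K′` the word is `Σ_κ Σ'_t K′(t, N•c)(inl κ, inr ν)·Φ_κ(t)
+ Σ_{ρ′} Σ'_{w′} K′(N•w′, N•c)(inr ρ′, inr ν)·Ψ_{ρ′}(w′)` with the two-leg face currents `Φ_κ(t) = Σ'_{(y,w)} ρ₁(y)ρ₂(w)·S κ t y w f g`, `Ψ_{ρ′}(w′) = Σ'_{(y,w)} ρ₁ρ₂·M ρ′ w′ y w f g`;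
(§2) for a block-covariant `𝒦` with column charges `chg` against `inr ν`, block-covariant `S`, covariant `M` and periodic weights, the `t`-sum regroups over one cell:
`= Σ_{r∈box N} Σ_κ chg(inl κ, r)·Φ_κ(r) + Σ_{ρ′} chg(inr ρ′, 0)·Ψ_{ρ′}(0)` — independent of `c`.

WHAT ([folklore]; generic `d`, block `N`; 0 `def`, 0 cited facts, 0 `def … : Prop`, 0 sorry):
§1 `summable_col_stencil_family`, **`tsum_twoFace_vertexOfK_col`**, `summable_colM_vertex_family`, **`tsum_twoFace_vertexOfM_col`**, **`tsum_twoFace_dM_col`** (`K′` with `Decays K′ C m`,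
`m > 0`; `S` `LocStencil` ∕ `M` `VertexFamily` at rate `m`; `|ρ₁|, |ρ₂| ≤ 1`).
§2 `twoFace_stencil_periodic`, `twoFace_vertexM_const`, **`tsum_col_twoFace_eq_sum_box`**, `tsum_colM_eq_charge`, **`tsum_colM_twoFace_eq_charge`**, **`tsum_twoFace_dM_eq_cell`**
(block-covariant `𝒦`: `shiftK (−N•t) 𝒦 = 𝒦`; `HasSum (u ↦ 𝒦 t (N•u) g (inr ν)) (chg g t)`).
Asserts NO value of Bałaban's tables; discharges NOTHING of (C)sym ∕ (Q-D) ∕ (Q-D-rate) ∕ «T2Shape» ∕ «T2Drift» ∕ (hW, hWall); NEVER «G-an2-4 closed» as (CONV-C); NOT D1, NOT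
`BetaPertH`, NOT continuum, NOT Clay.  2026-08-23; no existing file touched.
-/

noncomputable section

open Finset
open scoped BigOperators
open Literature.MathematicalPhysics.QuantumFieldTheory
open Literature.MathematicalPhysics.QuantumFieldTheory.Balaban1983to89
open Literature.MathematicalPhysics.QuantumFieldTheory.Balaban1983to89.Beta
open AffineAveraging (Form1 Site box toSite)
open B12Sec2to5 (l1 l1_nonneg)
open ExpKernelCalculus (MKer Decays BiLoc VertexFamily Zl Zl_nonneg shiftK summable_exp_shift' tsum_exp_shift' l1_sub_symm)
open OneStepResolventKernel (Fib LocStencil wsum)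
open OneStepKernelFamily (colH abs_colH_le vertexOfK vertexFamily_vertexOfK)
open InterLevelTransport (cwsum_apply)
open SecondOrderResponse (colM vertexOfM dM dM_apply vertexFamily_vertexOfM)
open Summit.QuantumFields.BalabanUV.Beta.GAN24.MultiplierVertexBondSum (abs_colM_le_fine)
open Summit.QuantumFields.BalabanUV.Beta.GAN24.TwoFaceWordAdditive (summable_twoFace_of_biLoc)
open Summit.QuantumFields.BalabanUV.Beta.GAN24.ExchangeSlotResum (tsum_twoFace_shiftK)
open Summit.QuantumFields.BalabanUV.Beta.GAN24.CoarseBondCellPairing (tsum_sum_mul_periodic_of_cov)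

namespace Summit.QuantumFields.BalabanUV.Beta.GAN24.SlotColumnTwoFaceWord

variable {d : ℕ} {N : ℕ} [NeZero N] {ρ₁ ρ₂ : Site (d + 1) → ℝ}

/-! ## §1 The two-face word of `dM K′ N S M ν c` through the `(ν, c)`-column of a decaying `K′` -/

section Column

variable {K' : MKer (d + 1) (Fib d)} {C m : ℝ} {S M : Fin (d + 1) → Site (d + 1) → MKer (d + 1) (Fib d)} {Cs CM : ℝ}

/-- [folklore] The exponential pair sum `Σ'_{(y,w)} e^{−m|y−t|}·e^{−m|w−t|} = Zl(m)²`. -/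
theorem hasSum_exp_pair (hm : 0 < m) (t : Site (d + 1)) :
    HasSum (fun yw : Site (d + 1) × Site (d + 1) => Real.exp (-m * l1 (yw.1 - t)) * Real.exp (-m * l1 (yw.2 - t))) (Zl (d + 1) m * Zl (d + 1) m) := by
  have h1 := summable_exp_shift' (D := d + 1) hm t
  have hprod := h1.mul_of_nonneg h1 (fun _ => (Real.exp_pos _).le) (fun _ => (Real.exp_pos _).le)
  have e := h1.tsum_mul_tsum h1 hprod
  rw [tsum_exp_shift' t] at e
  rw [e]
  exact hprod.hasSum

omit [NeZero N] in
/-- [folklore] **THE `(t, (y,w))` FAMILY `ρ₁(y)ρ₂(w)·K′(t, N•c)(inl κ, inr ν)·S κ t y w f g` IS ABSOLUTELY SUMMABLE** (decaying column × stencil localised at its slot × bounded weights). -/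
theorem summable_col_stencil_family (hK : Decays K' C m) (hm : 0 < m) (hS : LocStencil S Cs m) (h₁ : ∀ y, |ρ₁ y| ≤ 1) (h₂ : ∀ w, |ρ₂ w| ≤ 1)
    (ν : Fin (d + 1)) (c : Site (d + 1)) (κ : Fin (d + 1)) (f g : Fib d) :
    Summable fun q : Site (d + 1) × (Site (d + 1) × Site (d + 1)) =>
      ρ₁ q.2.1 * ρ₂ q.2.2 * (colH K' N ν c κ q.1 * S κ q.1 q.2.1 q.2.2 f g) := by
  have hC : 0 ≤ C := hK.nonneg (Sum.inl 0)
  have hCs : 0 ≤ Cs := (hS 0 0).nonneg (Sum.inl 0)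
  have hin : ∀ t : Site (d + 1), HasSum (fun yw : Site (d + 1) × Site (d + 1) =>
      (C * Real.exp (-m * l1 (t - (N : ℤ) • c))) * (Cs * (Real.exp (-m * l1 (yw.1 - t)) * Real.exp (-m * l1 (yw.2 - t)))))
      ((C * Real.exp (-m * l1 (t - (N : ℤ) • c))) * (Cs * (Zl (d + 1) m * Zl (d + 1) m))) :=
    fun t => ((hasSum_exp_pair hm t).mul_left Cs).mul_left _
  have hout : Summable fun t : Site (d + 1) => (C * Real.exp (-m * l1 (t - (N : ℤ) • c))) * (Cs * (Zl (d + 1) m * Zl (d + 1) m)) :=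
    ((summable_exp_shift' hm ((N : ℤ) • c)).mul_left C).mul_right _
  have hMs : Summable fun q : Site (d + 1) × (Site (d + 1) × Site (d + 1)) =>
      (C * Real.exp (-m * l1 (q.1 - (N : ℤ) • c))) * (Cs * (Real.exp (-m * l1 (q.2.1 - q.1)) * Real.exp (-m * l1 (q.2.2 - q.1)))) := by
    refine (summable_prod_of_nonneg fun q => by positivity).2 ⟨fun t => (hin t).summable, ?_⟩
    exact hout.congr fun t => ((hin t).tsum_eq).symm
  refine Summable.of_norm_bounded hMs (fun q => ?_)
  rw [Real.norm_eq_abs, abs_mul, abs_mul, abs_mul]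
  have hS' : |S κ q.1 q.2.1 q.2.2 f g| ≤ Cs * (Real.exp (-m * l1 (q.2.1 - q.1)) * Real.exp (-m * l1 (q.2.2 - q.1))) := by
    have h := hS κ q.1 q.2.1 q.2.2 f g
    rwa [mul_add, Real.exp_add] at h
  calc |ρ₁ q.2.1| * |ρ₂ q.2.2| * (|colH K' N ν c κ q.1| * |S κ q.1 q.2.1 q.2.2 f g|)
      ≤ 1 * 1 * ((C * Real.exp (-m * l1 (q.1 - (N : ℤ) • c))) * (Cs * (Real.exp (-m * l1 (q.2.1 - q.1)) * Real.exp (-m * l1 (q.2.2 - q.1))))) :=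
        mul_le_mul (mul_le_mul (h₁ _) (h₂ _) (abs_nonneg _) zero_le_one)
          (mul_le_mul (abs_colH_le (N := N) hK ν c κ q.1) hS' (abs_nonneg _) (by positivity)) (by positivity) (by positivity)
    _ = _ := by ring

omit [NeZero N] in
/-- [folklore] **THE TWO-FACE WORD OF `vertexOfK K′ N S ν c` THROUGH THE `(ν, c)`-COLUMN OF `K′`**: for `K′` decaying (rate `m > 0`), `S` a local stencil family (rate `m`), bounded
weights, every fibre pair,
`Σ'_{(y,w)} ρ₁(y)ρ₂(w)·vertexOfK K′ N S ν c y w f g = Σ_κ Σ'_t K′(t, N•c)(inl κ, inr ν) · Σ'_{(y,w)} ρ₁(y)ρ₂(w)·S κ t y w f g`. -/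
theorem tsum_twoFace_vertexOfK_col (hK : Decays K' C m) (hm : 0 < m) (hS : LocStencil S Cs m) (h₁ : ∀ y, |ρ₁ y| ≤ 1) (h₂ : ∀ w, |ρ₂ w| ≤ 1)
    (ν : Fin (d + 1)) (c : Site (d + 1)) (f g : Fib d) :
    (∑' yw : Site (d + 1) × Site (d + 1), ρ₁ yw.1 * ρ₂ yw.2 * vertexOfK K' N S ν c yw.1 yw.2 f g) =
      ∑ κ : Fin (d + 1), ∑' t : Site (d + 1), K' t ((N : ℤ) • c) (Sum.inl κ) (Sum.inr ν) *
        ∑' yw : Site (d + 1) × Site (d + 1), ρ₁ yw.1 * ρ₂ yw.2 * S κ t yw.1 yw.2 f g := by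
  have hG := fun κ => summable_col_stencil_family (N := N) hK hm hS h₁ h₂ ν c κ f g
  -- each colour: the `(y,w)`-sum of the `t`-sums is the `t`-sum of the `(y,w)`-sums
  have hκ : ∀ κ : Fin (d + 1),
      (∑' yw : Site (d + 1) × Site (d + 1), ∑' t : Site (d + 1), ρ₁ yw.1 * ρ₂ yw.2 * (colH K' N ν c κ t * S κ t yw.1 yw.2 f g)) =
        ∑' t : Site (d + 1), K' t ((N : ℤ) • c) (Sum.inl κ) (Sum.inr ν) * ∑' yw : Site (d + 1) × Site (d + 1), ρ₁ yw.1 * ρ₂ yw.2 * S κ t yw.1 yw.2 f g := by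
    intro κ
    have hG' : Summable fun q : (Site (d + 1) × Site (d + 1)) × Site (d + 1) => ρ₁ q.1.1 * ρ₂ q.1.2 * (colH K' N ν c κ q.2 * S κ q.2 q.1.1 q.1.2 f g) :=
      (hG κ).prod_symm
    have hc : (∑' yw : Site (d + 1) × Site (d + 1), ∑' t : Site (d + 1), ρ₁ yw.1 * ρ₂ yw.2 * (colH K' N ν c κ t * S κ t yw.1 yw.2 f g)) =
        ∑' t : Site (d + 1), ∑' yw : Site (d + 1) × Site (d + 1), ρ₁ yw.1 * ρ₂ yw.2 * (colH K' N ν c κ t * S κ t yw.1 yw.2 f g) := by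
      calc (∑' yw : Site (d + 1) × Site (d + 1), ∑' t : Site (d + 1), ρ₁ yw.1 * ρ₂ yw.2 * (colH K' N ν c κ t * S κ t yw.1 yw.2 f g))
          = ∑' q : (Site (d + 1) × Site (d + 1)) × Site (d + 1), ρ₁ q.1.1 * ρ₂ q.1.2 * (colH K' N ν c κ q.2 * S κ q.2 q.1.1 q.1.2 f g) := hG'.tsum_prod.symm
        _ = ∑' q : Site (d + 1) × (Site (d + 1) × Site (d + 1)), ρ₁ q.2.1 * ρ₂ q.2.2 * (colH K' N ν c κ q.1 * S κ q.1 q.2.1 q.2.2 f g) :=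
            (Equiv.prodComm (Site (d + 1) × Site (d + 1)) (Site (d + 1))).tsum_eq
              (fun q : Site (d + 1) × (Site (d + 1) × Site (d + 1)) => ρ₁ q.2.1 * ρ₂ q.2.2 * (colH K' N ν c κ q.1 * S κ q.1 q.2.1 q.2.2 f g))
        _ = _ := (hG κ).tsum_prod
    rw [hc]
    refine tsum_congr fun t => ?_
    rw [← tsum_mul_left]
    refine tsum_congr fun yw => ?_
    simp only [colH]
    ring
  -- pointwise summability in `(y,w)` of each colour's `t`-sum
  have hyw : ∀ κ : Fin (d + 1), Summable fun yw : Site (d + 1) × Site (d + 1) =>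
      ∑' t : Site (d + 1), ρ₁ yw.1 * ρ₂ yw.2 * (colH K' N ν c κ t * S κ t yw.1 yw.2 f g) := fun κ => (hG κ).prod_symm.prod
  calc (∑' yw : Site (d + 1) × Site (d + 1), ρ₁ yw.1 * ρ₂ yw.2 * vertexOfK K' N S ν c yw.1 yw.2 f g)
      = ∑' yw : Site (d + 1) × Site (d + 1), ∑ κ : Fin (d + 1), ∑' t : Site (d + 1), ρ₁ yw.1 * ρ₂ yw.2 * (colH K' N ν c κ t * S κ t yw.1 yw.2 f g) := by
        refine tsum_congr fun yw => ?_
        simp only [vertexOfK, wsum, Finset.mul_sum]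
        refine Finset.sum_congr rfl fun κ _ => ?_
        rw [← tsum_mul_left]
    _ = ∑ κ : Fin (d + 1), ∑' yw : Site (d + 1) × Site (d + 1), ∑' t : Site (d + 1), ρ₁ yw.1 * ρ₂ yw.2 * (colH K' N ν c κ t * S κ t yw.1 yw.2 f g) :=
        Summable.tsum_finsetSum fun κ _ => hyw κ
    _ = _ := Finset.sum_congr rfl fun κ _ => hκ κ

/-- [folklore] **THE `(w′, (y,w))` FAMILY `ρ₁(y)ρ₂(w)·K′(N•w′, N•c)(inr ρ′, inr ν)·M ρ′ w′ y w f g` IS ABSOLUTELY SUMMABLE** (decaying multiplier column × table localised at its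
coarse slot × bounded weights). -/
theorem summable_colM_vertex_family (hK : Decays K' C m) (hm : 0 < m) (hM : VertexFamily M N CM m) (h₁ : ∀ y, |ρ₁ y| ≤ 1) (h₂ : ∀ w, |ρ₂ w| ≤ 1)
    (ν : Fin (d + 1)) (c : Site (d + 1)) (ρ' : Fin (d + 1)) (f g : Fib d) :
    Summable fun q : Site (d + 1) × (Site (d + 1) × Site (d + 1)) =>
      ρ₁ q.2.1 * ρ₂ q.2.2 * (colM K' N ν c ρ' q.1 * M ρ' q.1 q.2.1 q.2.2 f g) := by
  have hN : 1 ≤ N := Nat.one_le_iff_ne_zero.2 (NeZero.ne N)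
  have hC : 0 ≤ C := hK.nonneg (Sum.inl 0)
  have hCM : 0 ≤ CM := (hM 0 0).nonneg (Sum.inl 0)
  have hin : ∀ w' : Site (d + 1), HasSum (fun yw : Site (d + 1) × Site (d + 1) =>
      (C * Real.exp (-m * l1 (w' - c))) * (CM * (Real.exp (-m * l1 (yw.1 - (N : ℤ) • w')) * Real.exp (-m * l1 (yw.2 - (N : ℤ) • w')))))
      ((C * Real.exp (-m * l1 (w' - c))) * (CM * (Zl (d + 1) m * Zl (d + 1) m))) :=
    fun w' => ((hasSum_exp_pair hm ((N : ℤ) • w')).mul_left CM).mul_left _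
  have hout : Summable fun w' : Site (d + 1) => (C * Real.exp (-m * l1 (w' - c))) * (CM * (Zl (d + 1) m * Zl (d + 1) m)) :=
    ((summable_exp_shift' hm c).mul_left C).mul_right _
  have hMs : Summable fun q : Site (d + 1) × (Site (d + 1) × Site (d + 1)) =>
      (C * Real.exp (-m * l1 (q.1 - c))) * (CM * (Real.exp (-m * l1 (q.2.1 - (N : ℤ) • q.1)) * Real.exp (-m * l1 (q.2.2 - (N : ℤ) • q.1)))) := by
    refine (summable_prod_of_nonneg fun q => by positivity).2 ⟨fun w' => (hin w').summable, ?_⟩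
    exact hout.congr fun w' => ((hin w').tsum_eq).symm
  refine Summable.of_norm_bounded hMs (fun q => ?_)
  rw [Real.norm_eq_abs, abs_mul, abs_mul, abs_mul]
  have hM' : |M ρ' q.1 q.2.1 q.2.2 f g| ≤ CM * (Real.exp (-m * l1 (q.2.1 - (N : ℤ) • q.1)) * Real.exp (-m * l1 (q.2.2 - (N : ℤ) • q.1))) := by
    have h := hM ρ' q.1 q.2.1 q.2.2 f g
    rwa [mul_add, Real.exp_add] at h
  calc |ρ₁ q.2.1| * |ρ₂ q.2.2| * (|colM K' N ν c ρ' q.1| * |M ρ' q.1 q.2.1 q.2.2 f g|)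
      ≤ 1 * 1 * ((C * Real.exp (-m * l1 (q.1 - c))) * (CM * (Real.exp (-m * l1 (q.2.1 - (N : ℤ) • q.1)) * Real.exp (-m * l1 (q.2.2 - (N : ℤ) • q.1))))) :=
        mul_le_mul (mul_le_mul (h₁ _) (h₂ _) (abs_nonneg _) zero_le_one)
          (mul_le_mul (abs_colM_le_fine (N := N) hK hm.le ν c ρ' q.1) hM' (abs_nonneg _) (by positivity)) (by positivity) (by positivity)
    _ = _ := by ring

/-- [folklore] **THE TWO-FACE WORD OF `vertexOfM K′ N M ν c` THROUGH THE MULTIPLIER ENTRIES OF THE `(ν, c)`-COLUMN OF `K′`**: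
`Σ'_{(y,w)} ρ₁(y)ρ₂(w)·vertexOfM K′ N M ν c y w f g = Σ_{ρ′} Σ'_{w′} K′(N•w′, N•c)(inr ρ′, inr ν) · Σ'_{(y,w)} ρ₁(y)ρ₂(w)·M ρ′ w′ y w f g`. -/
theorem tsum_twoFace_vertexOfM_col (hK : Decays K' C m) (hm : 0 < m) (hM : VertexFamily M N CM m) (h₁ : ∀ y, |ρ₁ y| ≤ 1) (h₂ : ∀ w, |ρ₂ w| ≤ 1)
    (ν : Fin (d + 1)) (c : Site (d + 1)) (f g : Fib d) :
    (∑' yw : Site (d + 1) × Site (d + 1), ρ₁ yw.1 * ρ₂ yw.2 * vertexOfM K' N M ν c yw.1 yw.2 f g) =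
      ∑ ρ' : Fin (d + 1), ∑' w' : Site (d + 1), K' ((N : ℤ) • w') ((N : ℤ) • c) (Sum.inr ρ') (Sum.inr ν) *
        ∑' yw : Site (d + 1) × Site (d + 1), ρ₁ yw.1 * ρ₂ yw.2 * M ρ' w' yw.1 yw.2 f g := by
  have hG := fun ρ' => summable_colM_vertex_family (N := N) hK hm hM h₁ h₂ ν c ρ' f g
  have hρ : ∀ ρ' : Fin (d + 1),
      (∑' yw : Site (d + 1) × Site (d + 1), ∑' w' : Site (d + 1), ρ₁ yw.1 * ρ₂ yw.2 * (colM K' N ν c ρ' w' * M ρ' w' yw.1 yw.2 f g)) =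
        ∑' w' : Site (d + 1), K' ((N : ℤ) • w') ((N : ℤ) • c) (Sum.inr ρ') (Sum.inr ν) * ∑' yw : Site (d + 1) × Site (d + 1), ρ₁ yw.1 * ρ₂ yw.2 * M ρ' w' yw.1 yw.2 f g := by
    intro ρ'
    have hG' : Summable fun q : (Site (d + 1) × Site (d + 1)) × Site (d + 1) => ρ₁ q.1.1 * ρ₂ q.1.2 * (colM K' N ν c ρ' q.2 * M ρ' q.2 q.1.1 q.1.2 f g) :=
      (hG ρ').prod_symm
    have hc : (∑' yw : Site (d + 1) × Site (d + 1), ∑' w' : Site (d + 1), ρ₁ yw.1 * ρ₂ yw.2 * (colM K' N ν c ρ' w' * M ρ' w' yw.1 yw.2 f g)) =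
        ∑' w' : Site (d + 1), ∑' yw : Site (d + 1) × Site (d + 1), ρ₁ yw.1 * ρ₂ yw.2 * (colM K' N ν c ρ' w' * M ρ' w' yw.1 yw.2 f g) := by
      calc (∑' yw : Site (d + 1) × Site (d + 1), ∑' w' : Site (d + 1), ρ₁ yw.1 * ρ₂ yw.2 * (colM K' N ν c ρ' w' * M ρ' w' yw.1 yw.2 f g))
          = ∑' q : (Site (d + 1) × Site (d + 1)) × Site (d + 1), ρ₁ q.1.1 * ρ₂ q.1.2 * (colM K' N ν c ρ' q.2 * M ρ' q.2 q.1.1 q.1.2 f g) := hG'.tsum_prod.symm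
        _ = ∑' q : Site (d + 1) × (Site (d + 1) × Site (d + 1)), ρ₁ q.2.1 * ρ₂ q.2.2 * (colM K' N ν c ρ' q.1 * M ρ' q.1 q.2.1 q.2.2 f g) :=
            (Equiv.prodComm (Site (d + 1) × Site (d + 1)) (Site (d + 1))).tsum_eq
              (fun q : Site (d + 1) × (Site (d + 1) × Site (d + 1)) => ρ₁ q.2.1 * ρ₂ q.2.2 * (colM K' N ν c ρ' q.1 * M ρ' q.1 q.2.1 q.2.2 f g))
        _ = _ := (hG ρ').tsum_prod
    rw [hc]
    refine tsum_congr fun w' => ?_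
    rw [← tsum_mul_left]
    refine tsum_congr fun yw => ?_
    simp only [colM]
    ring
  have hyw : ∀ ρ' : Fin (d + 1), Summable fun yw : Site (d + 1) × Site (d + 1) =>
      ∑' w' : Site (d + 1), ρ₁ yw.1 * ρ₂ yw.2 * (colM K' N ν c ρ' w' * M ρ' w' yw.1 yw.2 f g) := fun ρ' => (hG ρ').prod_symm.prod
  calc (∑' yw : Site (d + 1) × Site (d + 1), ρ₁ yw.1 * ρ₂ yw.2 * vertexOfM K' N M ν c yw.1 yw.2 f g)
      = ∑' yw : Site (d + 1) × Site (d + 1), ∑ ρ' : Fin (d + 1), ∑' w' : Site (d + 1), ρ₁ yw.1 * ρ₂ yw.2 * (colM K' N ν c ρ' w' * M ρ' w' yw.1 yw.2 f g) := by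
        refine tsum_congr fun yw => ?_
        simp only [vertexOfM, cwsum_apply, Finset.mul_sum]
        refine Finset.sum_congr rfl fun ρ' _ => ?_
        rw [← tsum_mul_left]
    _ = ∑ ρ' : Fin (d + 1), ∑' yw : Site (d + 1) × Site (d + 1), ∑' w' : Site (d + 1), ρ₁ yw.1 * ρ₂ yw.2 * (colM K' N ν c ρ' w' * M ρ' w' yw.1 yw.2 f g) :=
        Summable.tsum_finsetSum fun ρ' _ => hyw ρ'
    _ = _ := Finset.sum_congr rfl fun ρ' _ => hρ ρ'

/-- [folklore] **THE TWO-FACE WORD OF THE BACKGROUND DERIVATIVE `dM K′ N S M ν c` THROUGH THE `(ν, c)`-COLUMN OF `K′`** (field entries against the stencil currents, multiplier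
entries against the multiplier-table currents): the sum of `tsum_twoFace_vertexOfK_col` and `tsum_twoFace_vertexOfM_col`. -/
theorem tsum_twoFace_dM_col (hK : Decays K' C m) (hm : 0 < m) (hS : LocStencil S Cs m) (hM : VertexFamily M N CM m) (h₁ : ∀ y, |ρ₁ y| ≤ 1) (h₂ : ∀ w, |ρ₂ w| ≤ 1)
    (ν : Fin (d + 1)) (c : Site (d + 1)) (f g : Fib d) :
    (∑' yw : Site (d + 1) × Site (d + 1), ρ₁ yw.1 * ρ₂ yw.2 * dM K' N S M ν c yw.1 yw.2 f g) =
      (∑ κ : Fin (d + 1), ∑' t : Site (d + 1), K' t ((N : ℤ) • c) (Sum.inl κ) (Sum.inr ν) *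
          ∑' yw : Site (d + 1) × Site (d + 1), ρ₁ yw.1 * ρ₂ yw.2 * S κ t yw.1 yw.2 f g) +
        ∑ ρ' : Fin (d + 1), ∑' w' : Site (d + 1), K' ((N : ℤ) • w') ((N : ℤ) • c) (Sum.inr ρ') (Sum.inr ν) *
          ∑' yw : Site (d + 1) × Site (d + 1), ρ₁ yw.1 * ρ₂ yw.2 * M ρ' w' yw.1 yw.2 f g := by
  have hC : 0 ≤ C := hK.nonneg (Sum.inl 0)
  have hV := vertexFamily_vertexOfK (N := N) hK hC hS hm le_rfl ν c
  have hW := vertexFamily_vertexOfM (N := N) hK hC hM hm le_rfl ν c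
  have hs1 := summable_twoFace_of_biLoc hV (half_pos hm) h₁ h₂ f g
  have hs2 := summable_twoFace_of_biLoc hW (half_pos hm) h₁ h₂ f g
  rw [← tsum_twoFace_vertexOfK_col hK hm hS h₁ h₂ ν c f g, ← tsum_twoFace_vertexOfM_col hK hm hM h₁ h₂ ν c f g, ← hs1.tsum_add hs2]
  refine tsum_congr fun yw => ?_
  rw [dM_apply]
  ring

end Column

/-! ## §2 The cell form for a block-covariant kernel: column charges against the currents over one cell -/

section Cell

variable {𝒦 : MKer (d + 1) (Fib d)} {C m : ℝ} {S M : Fin (d + 1) → Site (d + 1) → MKer (d + 1) (Fib d)} {Cs CM : ℝ} {chg : Fib d → Site (d + 1) → ℝ}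

omit [NeZero N] in
/-- [folklore] **THE TWO-LEG FACE CURRENT OF A BLOCK-COVARIANT STENCIL FAMILY IS `N`-PERIODIC IN THE SLOT** (`S κ (t + N•s) = shiftK (−N•s) (S κ t)`, periodic weights;
`ExchangeSlotResum.tsum_twoFace_shiftK`). -/
theorem twoFace_stencil_periodic (hScov : ∀ (κ : Fin (d + 1)) (u t : Site (d + 1)), S κ (u + (N : ℤ) • t) = shiftK (-((N : ℤ) • t)) (S κ u))
    (hρ₁ : ∀ y s : Site (d + 1), ρ₁ (y + (N : ℤ) • s) = ρ₁ y) (hρ₂ : ∀ w s : Site (d + 1), ρ₂ (w + (N : ℤ) • s) = ρ₂ w)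
    (κ : Fin (d + 1)) (t s : Site (d + 1)) (f g : Fib d) :
    (∑' yw : Site (d + 1) × Site (d + 1), ρ₁ yw.1 * ρ₂ yw.2 * S κ (t + (N : ℤ) • s) yw.1 yw.2 f g) =
      ∑' yw : Site (d + 1) × Site (d + 1), ρ₁ yw.1 * ρ₂ yw.2 * S κ t yw.1 yw.2 f g := by
  rw [hScov κ t s]
  exact tsum_twoFace_shiftK (N := N) hρ₁ hρ₂ (S κ t) s f g

omit [NeZero N] in
/-- [folklore] **THE TWO-LEG FACE CURRENT OF A COVARIANT MULTIPLIER TABLE IS CONSTANT IN THE COARSE SLOT** (`M ρ′ (w + t) = shiftK (−N•t) (M ρ′ w)`, periodic weights). -/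
theorem twoFace_vertexM_const (hMcov : ∀ (ρ' : Fin (d + 1)) (w t : Site (d + 1)), M ρ' (w + t) = shiftK (-((N : ℤ) • t)) (M ρ' w))
    (hρ₁ : ∀ y s : Site (d + 1), ρ₁ (y + (N : ℤ) • s) = ρ₁ y) (hρ₂ : ∀ w s : Site (d + 1), ρ₂ (w + (N : ℤ) • s) = ρ₂ w)
    (ρ' : Fin (d + 1)) (w' : Site (d + 1)) (f g : Fib d) :
    (∑' yw : Site (d + 1) × Site (d + 1), ρ₁ yw.1 * ρ₂ yw.2 * M ρ' w' yw.1 yw.2 f g) =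
      ∑' yw : Site (d + 1) × Site (d + 1), ρ₁ yw.1 * ρ₂ yw.2 * M ρ' 0 yw.1 yw.2 f g := by
  have h := hMcov ρ' 0 w'
  rw [zero_add] at h
  rw [h]
  exact tsum_twoFace_shiftK (N := N) hρ₁ hρ₂ (M ρ' 0) w' f g

/-- [folklore] **THE FIELD HALF REGROUPS OVER ONE CELL**: for a block-covariant decaying `𝒦` (`shiftK (−N•t) 𝒦 = 𝒦`) with column charges `HasSum (u ↦ 𝒦 t (N•u) g (inr ν)) (chg g t)`,
a block-covariant local stencil family `S` (rate `m`) and periodic bounded weights, for EVERY outer bond `c`: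
`Σ_κ Σ'_t 𝒦(t, N•c)(inl κ, inr ν)·Φ_κ(t) = Σ_{r ∈ box N} Σ_κ chg(inl κ, r)·Φ_κ(r)`, `Φ_κ(t) = Σ'_{(y,w)} ρ₁(y)ρ₂(w)·S κ t y w f g`
(`CoarseBondCellPairing.tsum_sum_mul_periodic_of_cov` with the covariant family `j u κ t = 𝒦(t, N•u)(inl κ, inr ν)`). -/
theorem tsum_col_twoFace_eq_sum_box (hK : Decays 𝒦 C m) (hm : 0 < m) (hKcov : ∀ t : Site (d + 1), shiftK (-((N : ℤ) • t)) 𝒦 = 𝒦) (ν : Fin (d + 1))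
    (hcol : ∀ (g : Fib d) (t : Site (d + 1)), HasSum (fun u : Site (d + 1) => 𝒦 t ((N : ℤ) • u) g (Sum.inr ν)) (chg g t))
    (hS : LocStencil S Cs m) (hScov : ∀ (κ : Fin (d + 1)) (u t : Site (d + 1)), S κ (u + (N : ℤ) • t) = shiftK (-((N : ℤ) • t)) (S κ u))
    (h₁ : ∀ y, |ρ₁ y| ≤ 1) (h₂ : ∀ w, |ρ₂ w| ≤ 1)
    (hρ₁ : ∀ y s : Site (d + 1), ρ₁ (y + (N : ℤ) • s) = ρ₁ y) (hρ₂ : ∀ w s : Site (d + 1), ρ₂ (w + (N : ℤ) • s) = ρ₂ w)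
    (c : Site (d + 1)) (f g : Fib d) :
    (∑ κ : Fin (d + 1), ∑' t : Site (d + 1), 𝒦 t ((N : ℤ) • c) (Sum.inl κ) (Sum.inr ν) *
        ∑' yw : Site (d + 1) × Site (d + 1), ρ₁ yw.1 * ρ₂ yw.2 * S κ t yw.1 yw.2 f g) =
      ∑ r ∈ box (d + 1) N, ∑ κ : Fin (d + 1), chg (Sum.inl κ) (toSite r) *
        ∑' yw : Site (d + 1) × Site (d + 1), ρ₁ yw.1 * ρ₂ yw.2 * S κ (toSite r) yw.1 yw.2 f g := by
  have hC : 0 ≤ C := hK.nonneg (Sum.inl 0)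
  have hCs : 0 ≤ Cs := (hS 0 0).nonneg (Sum.inl 0)
  -- the current is bounded and periodic
  have hΦb : ∀ (κ : Fin (d + 1)) (t : Site (d + 1)), |∑' yw : Site (d + 1) × Site (d + 1), ρ₁ yw.1 * ρ₂ yw.2 * S κ t yw.1 yw.2 f g| ≤ Cs * (Zl (d + 1) m * Zl (d + 1) m) := by
    intro κ t
    have hmaj := ((hasSum_exp_pair (d := d) hm t).mul_left Cs)
    have hb := tsum_of_norm_bounded hmaj (f := fun yw : Site (d + 1) × Site (d + 1) => ρ₁ yw.1 * ρ₂ yw.2 * S κ t yw.1 yw.2 f g) (fun yw => ?_)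
    · rw [Real.norm_eq_abs] at hb
      exact hb
    · rw [Real.norm_eq_abs, abs_mul, abs_mul]
      have h := hS κ t yw.1 yw.2 f g
      rw [mul_add, Real.exp_add] at h
      calc |ρ₁ yw.1| * |ρ₂ yw.2| * |S κ t yw.1 yw.2 f g| ≤ 1 * 1 * (Cs * (Real.exp (-m * l1 (yw.1 - t)) * Real.exp (-m * l1 (yw.2 - t)))) :=
            mul_le_mul (mul_le_mul (h₁ _) (h₂ _) (abs_nonneg _) zero_le_one) h (abs_nonneg _) (by positivity)
        _ = _ := by ring
  have hjy : ∀ (u : Site (d + 1)) (κ : Fin (d + 1)), Summable fun t : Site (d + 1) => 𝒦 t ((N : ℤ) • u) (Sum.inl κ) (Sum.inr ν) *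
      ∑' yw : Site (d + 1) × Site (d + 1), ρ₁ yw.1 * ρ₂ yw.2 * S κ t yw.1 yw.2 f g := by
    intro u κ
    refine Summable.of_norm_bounded (((summable_exp_shift' hm ((N : ℤ) • u)).mul_left C).mul_right (Cs * (Zl (d + 1) m * Zl (d + 1) m))) (fun t => ?_)
    rw [Real.norm_eq_abs, abs_mul]
    exact mul_le_mul (hK t ((N : ℤ) • u) (Sum.inl κ) (Sum.inr ν)) (hΦb κ t) (abs_nonneg _) (by positivity)
  have hcov : ∀ (u : Site (d + 1)) (κ : Fin (d + 1)) (t s : Site (d + 1)),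
      𝒦 (t + (N : ℤ) • s) ((N : ℤ) • (u + s)) (Sum.inl κ) (Sum.inr ν) = 𝒦 t ((N : ℤ) • u) (Sum.inl κ) (Sum.inr ν) := by
    intro u κ t s
    have h := congrFun (congrFun (congrFun (congrFun (hKcov s) (t + (N : ℤ) • s)) ((N : ℤ) • (u + s))) (Sum.inl κ)) (Sum.inr ν)
    simp only [shiftK, smul_add, add_neg_cancel_right] at h
    rw [smul_add]
    exact h.symm
  have hA : ∀ (κ : Fin (d + 1)) (t s : Site (d + 1)),
      (∑' yw : Site (d + 1) × Site (d + 1), ρ₁ yw.1 * ρ₂ yw.2 * S κ (t + (N : ℤ) • s) yw.1 yw.2 f g) =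
        ∑' yw : Site (d + 1) × Site (d + 1), ρ₁ yw.1 * ρ₂ yw.2 * S κ t yw.1 yw.2 f g :=
    fun κ t s => twoFace_stencil_periodic (N := N) hScov hρ₁ hρ₂ κ t s f g
  have key := tsum_sum_mul_periodic_of_cov (N := N)
    (j := fun (u : Site (d + 1)) (κ : Fin (d + 1)) (t : Site (d + 1)) => 𝒦 t ((N : ℤ) • u) (Sum.inl κ) (Sum.inr ν))
    (A := fun (κ : Fin (d + 1)) (t : Site (d + 1)) => ∑' yw : Site (d + 1) × Site (d + 1), ρ₁ yw.1 * ρ₂ yw.2 * S κ t yw.1 yw.2 f g)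
    hcov hA c (hjy c)
  rw [Summable.tsum_finsetSum (fun κ _ => hjy c κ)] at key
  rw [key]
  refine Finset.sum_congr rfl fun r _ => Finset.sum_congr rfl fun κ _ => ?_
  rw [(hcol (Sum.inl κ) (toSite r)).tsum_eq]

omit [NeZero N] in
/-- [folklore] **THE FIRST-INDEX SUM OF A BLOCK-COVARIANT KERNEL AT A FIXED COARSE COLUMN IS ITS COLUMN CHARGE AT THE ORIGIN**:
`Σ'_{w′} 𝒦(N•w′, N•c)(g, inr ν) = chg(g, 0)` (covariance `𝒦(N•w′, N•c) = 𝒦(0, N•(c − w′))`, reindexing `w′ ↦ c − w′`). -/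
theorem tsum_colM_eq_charge (hKcov : ∀ t : Site (d + 1), shiftK (-((N : ℤ) • t)) 𝒦 = 𝒦) (ν : Fin (d + 1))
    (hcol : ∀ (g : Fib d) (t : Site (d + 1)), HasSum (fun u : Site (d + 1) => 𝒦 t ((N : ℤ) • u) g (Sum.inr ν)) (chg g t))
    (c : Site (d + 1)) (g : Fib d) :
    (∑' w' : Site (d + 1), 𝒦 ((N : ℤ) • w') ((N : ℤ) • c) g (Sum.inr ν)) = chg g 0 := by
  have e : ∀ w' : Site (d + 1), 𝒦 ((N : ℤ) • w') ((N : ℤ) • c) g (Sum.inr ν) = 𝒦 0 ((N : ℤ) • (c - w')) g (Sum.inr ν) := by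
    intro w'
    have h := congrFun (congrFun (congrFun (congrFun (hKcov w') ((N : ℤ) • w')) ((N : ℤ) • c)) g) (Sum.inr ν)
    simp only [shiftK] at h
    rw [← h, add_neg_cancel, smul_sub, sub_eq_add_neg]
  rw [tsum_congr e]
  exact ((Equiv.subLeft c).tsum_eq (fun u : Site (d + 1) => 𝒦 0 ((N : ℤ) • u) g (Sum.inr ν))).trans (hcol g 0).tsum_eq

omit [NeZero N] in
/-- [folklore] **THE MULTIPLIER HALF IS THE `inr` COLUMN CHARGE AT THE ORIGIN TIMES THE CONSTANT CURRENT**: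
`Σ_{ρ′} Σ'_{w′} 𝒦(N•w′, N•c)(inr ρ′, inr ν)·Ψ_{ρ′}(w′) = Σ_{ρ′} chg(inr ρ′, 0)·Ψ_{ρ′}(0)`, `Ψ_{ρ′}(w′) = Σ'_{(y,w)} ρ₁(y)ρ₂(w)·M ρ′ w′ y w f g` (constant in `w′`). -/
theorem tsum_colM_twoFace_eq_charge (hKcov : ∀ t : Site (d + 1), shiftK (-((N : ℤ) • t)) 𝒦 = 𝒦) (ν : Fin (d + 1))
    (hcol : ∀ (g : Fib d) (t : Site (d + 1)), HasSum (fun u : Site (d + 1) => 𝒦 t ((N : ℤ) • u) g (Sum.inr ν)) (chg g t))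
    (hMcov : ∀ (ρ' : Fin (d + 1)) (w t : Site (d + 1)), M ρ' (w + t) = shiftK (-((N : ℤ) • t)) (M ρ' w))
    (hρ₁ : ∀ y s : Site (d + 1), ρ₁ (y + (N : ℤ) • s) = ρ₁ y) (hρ₂ : ∀ w s : Site (d + 1), ρ₂ (w + (N : ℤ) • s) = ρ₂ w)
    (c : Site (d + 1)) (f g : Fib d) :
    (∑ ρ' : Fin (d + 1), ∑' w' : Site (d + 1), 𝒦 ((N : ℤ) • w') ((N : ℤ) • c) (Sum.inr ρ') (Sum.inr ν) *
        ∑' yw : Site (d + 1) × Site (d + 1), ρ₁ yw.1 * ρ₂ yw.2 * M ρ' w' yw.1 yw.2 f g) =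
      ∑ ρ' : Fin (d + 1), chg (Sum.inr ρ') 0 * ∑' yw : Site (d + 1) × Site (d + 1), ρ₁ yw.1 * ρ₂ yw.2 * M ρ' 0 yw.1 yw.2 f g := by
  refine Finset.sum_congr rfl fun ρ' _ => ?_
  have e : ∀ w' : Site (d + 1), 𝒦 ((N : ℤ) • w') ((N : ℤ) • c) (Sum.inr ρ') (Sum.inr ν) * (∑' yw : Site (d + 1) × Site (d + 1), ρ₁ yw.1 * ρ₂ yw.2 * M ρ' w' yw.1 yw.2 f g) =
      𝒦 ((N : ℤ) • w') ((N : ℤ) • c) (Sum.inr ρ') (Sum.inr ν) * (∑' yw : Site (d + 1) × Site (d + 1), ρ₁ yw.1 * ρ₂ yw.2 * M ρ' 0 yw.1 yw.2 f g) :=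
    fun w' => by rw [twoFace_vertexM_const (N := N) hMcov hρ₁ hρ₂ ρ' w' f g]
  rw [tsum_congr e, tsum_mul_right, tsum_colM_eq_charge (N := N) hKcov ν hcol c (Sum.inr ρ')]

/-- [folklore] **THE TWO-FACE WORD OF `dM 𝒦 N S M ν c` FOR A BLOCK-COVARIANT DECAYING `𝒦` IS THE CELL PAIRING OF ITS COLUMN CHARGES WITH THE TWO-LEG FACE CURRENTS** (every
outer bond `c` gives the same number):
`Σ'_{(y,w)} ρ₁(y)ρ₂(w)·dM 𝒦 N S M ν c y w f g = Σ_{r∈box N} Σ_κ chg(inl κ, r)·Φ_κ(r) + Σ_{ρ′} chg(inr ρ′, 0)·Ψ_{ρ′}(0)`. -/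
theorem tsum_twoFace_dM_eq_cell (hK : Decays 𝒦 C m) (hm : 0 < m) (hKcov : ∀ t : Site (d + 1), shiftK (-((N : ℤ) • t)) 𝒦 = 𝒦) (ν : Fin (d + 1))
    (hcol : ∀ (g : Fib d) (t : Site (d + 1)), HasSum (fun u : Site (d + 1) => 𝒦 t ((N : ℤ) • u) g (Sum.inr ν)) (chg g t))
    (hS : LocStencil S Cs m) (hScov : ∀ (κ : Fin (d + 1)) (u t : Site (d + 1)), S κ (u + (N : ℤ) • t) = shiftK (-((N : ℤ) • t)) (S κ u))
    (hM : VertexFamily M N CM m) (hMcov : ∀ (ρ' : Fin (d + 1)) (w t : Site (d + 1)), M ρ' (w + t) = shiftK (-((N : ℤ) • t)) (M ρ' w))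
    (h₁ : ∀ y, |ρ₁ y| ≤ 1) (h₂ : ∀ w, |ρ₂ w| ≤ 1)
    (hρ₁ : ∀ y s : Site (d + 1), ρ₁ (y + (N : ℤ) • s) = ρ₁ y) (hρ₂ : ∀ w s : Site (d + 1), ρ₂ (w + (N : ℤ) • s) = ρ₂ w)
    (c : Site (d + 1)) (f g : Fib d) :
    (∑' yw : Site (d + 1) × Site (d + 1), ρ₁ yw.1 * ρ₂ yw.2 * dM 𝒦 N S M ν c yw.1 yw.2 f g) =
      (∑ r ∈ box (d + 1) N, ∑ κ : Fin (d + 1), chg (Sum.inl κ) (toSite r) *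
          ∑' yw : Site (d + 1) × Site (d + 1), ρ₁ yw.1 * ρ₂ yw.2 * S κ (toSite r) yw.1 yw.2 f g) +
        ∑ ρ' : Fin (d + 1), chg (Sum.inr ρ') 0 * ∑' yw : Site (d + 1) × Site (d + 1), ρ₁ yw.1 * ρ₂ yw.2 * M ρ' 0 yw.1 yw.2 f g := by
  rw [tsum_twoFace_dM_col (N := N) hK hm hS hM h₁ h₂ ν c f g, tsum_col_twoFace_eq_sum_box (N := N) hK hm hKcov ν hcol hS hScov h₁ h₂ hρ₁ hρ₂ c f g,
    tsum_colM_twoFace_eq_charge (N := N) hKcov ν hcol hMcov hρ₁ hρ₂ c f g]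

end Cell

end Summit.QuantumFields.BalabanUV.Beta.GAN24.SlotColumnTwoFaceWord

end
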